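import Summits.KontsevichZagierPeriods.Zeta5Search.Barrier.ConeGammaS7CritSwap
import Summits.KontsevichZagierPeriods.Zeta5Search.Barrier.ConeGammaS7CritBlock
import Summits.KontsevichZagierPeriods.Zeta5Search.Barrier.ConeGammaS7Reduction

/-!
# ζ(5) search — BARRIER: the critical-value cocycle on non-degenerate `S₇`-orbits; `γ` and `Regular` as class functions

HONEST FRAMING (cell `pub-zeta5`): systematic search; no irrationality claim unless kernel-certified. MODEL objects
under Brown–Zudilin's (28)+(30) accounting ([BZ22] = arXiv:2210.03391; (28) observed, not proved); statements about
BZ's §5 critical system under the hypergeometric group; nothing here is about the size of any critical value, the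
cone's supremum (C2 = `BarrierC2`, OPEN), S-E (CONJECTURED) or `ζ(5)`. No number or sentence of record moves.
Records in print UNMOVED. Prover P2 g21 (self-selected Lean-only item, file 5).

* `critVals_permAct_eq_image_of_transfer_at` — set cocycle for an involution from pointwise transfers at `a` and
  at `t·a`;
* **`critVals_permAct_swap45`** — the SET cocycle for the Möbius generator `(56)` at a direction `a` whose critical
  points, and those of `(56)·a`, are all loss-free (`y′ ≠ 0`, `Q₅ ≠ 0` — the two conditions of `ConeGammaS7CritSwap`);
* `entropyCocycle_mul`, `critShift_one`, `critShift_mul` — the cocycle property `ΔE(gh; a) = ΔE(g; a) + ΔE(h; g·a)`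
  and closure of the set cocycle under products;
* **`critVals_permAct_of_nondegenerate`** — if `a` lies in the OPEN box and EVERY direction of its `S₇`-orbit is
  loss-free for `(56)`, then `critVals (g·a) = critVals a + ΔE(g; a)` for ALL `g ∈ S₇` (induction over the adjacent
  transpositions, `Equiv.Perm.mclosure_swap_castSucc_succ`, each written in the generators `(34), (45), π, (56)`);
* **`regular_permAct_of_nondegenerate`, `gamma_permAct_of_nondegenerate`** — on such orbits `Regular` and `γ` are
  class functions (discharging the hypotheses of P2 g20's `gamma_permAct_of_critShift` exactly where they hold).
The loss-free hypothesis is NOT vacuous and NOT always true: `ConeGammaS7CritWitness` exhibits an integer direction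
of the cone with a critical point at `y′ = 0`.
-/

noncomputable section

open Finset

namespace Summit.KontsevichZagierPeriods.Zeta5Search.Barrier.ConeGamma

/-! ### From pointwise transfers at `a` and `t·a` to the set cocycle -/

/-- Set cocycle for an involution `t` from pointwise transfers at `s = sParam a` and at `t·s`. -/
theorem critVals_permAct_eq_image_of_transfer_at {t : Equiv.Perm (Fin 7)} (ht : t * t = 1) (a : Dir)
    (h₁ : ∀ x y : ℝ, IsCritical (aOfS (sParam a)) x y →
      ∃ x' y', IsCritical (aOfS (permS t (sParam a))) x' y'
        ∧ growthLogR (pR (aOfS (permS t (sParam a)))) (qR (aOfS (permS t (sParam a)))) x' y'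
          = growthLogR (pR (aOfS (sParam a))) (qR (aOfS (sParam a))) x y
            + (∑ i ∈ FIdx, h28 (aOfS (permS t (sParam a))) i * Real.log (h28 (aOfS (permS t (sParam a))) i)
              - ∑ i ∈ FIdx, h28 (aOfS (sParam a)) i * Real.log (h28 (aOfS (sParam a)) i)))
    (h₂ : ∀ x y : ℝ, IsCritical (aOfS (permS t (sParam a))) x y →
      ∃ x' y', IsCritical (aOfS (permS t (permS t (sParam a)))) x' y'
        ∧ growthLogR (pR (aOfS (permS t (permS t (sParam a))))) (qR (aOfS (permS t (permS t (sParam a))))) x' y'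
          = growthLogR (pR (aOfS (permS t (sParam a)))) (qR (aOfS (permS t (sParam a)))) x y
            + (∑ i ∈ FIdx, h28 (aOfS (permS t (permS t (sParam a)))) i
                * Real.log (h28 (aOfS (permS t (permS t (sParam a)))) i)
              - ∑ i ∈ FIdx, h28 (aOfS (permS t (sParam a))) i * Real.log (h28 (aOfS (permS t (sParam a))) i))) :
    critVals (permAct t a)
      = (fun v => v + ∑ i ∈ FIdx, (h28 (permAct t a) i * Real.log (h28 (permAct t a) i)
          - h28 a i * Real.log (h28 a i))) '' critVals a := by
  have hss : permS t (permS t (sParam a)) = sParam a := by rw [permS_permS, ht, permS_one]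
  rw [hss, aOfS_sParam] at h₂
  rw [aOfS_sParam] at h₁
  have hΔ : ∑ i ∈ FIdx, (h28 (permAct t a) i * Real.log (h28 (permAct t a) i) - h28 a i * Real.log (h28 a i))
      = ∑ i ∈ FIdx, h28 (aOfS (permS t (sParam a))) i * Real.log (h28 (aOfS (permS t (sParam a))) i)
        - ∑ i ∈ FIdx, h28 a i * Real.log (h28 a i) := by
    rw [Finset.sum_sub_distrib]; rfl
  ext v
  simp only [critVals, Set.mem_setOf_eq, Set.mem_image]
  constructor
  · rintro ⟨x, y, hc, rfl⟩
    obtain ⟨x', y', hc2, hg2⟩ := h₂ x y hc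
    refine ⟨growthLogR (pR a) (qR a) x' y', ⟨x', y', hc2, rfl⟩, ?_⟩
    rw [hΔ, hg2]
    change _ = growthLogR (pR (aOfS (permS t (sParam a)))) (qR (aOfS (permS t (sParam a)))) x y
    ring
  · rintro ⟨w, ⟨x, y, hc, rfl⟩, rfl⟩
    obtain ⟨x', y', hc2, hg2⟩ := h₁ x y hc
    refine ⟨x', y', hc2, ?_⟩
    rw [hΔ]
    change _ = growthLogR (pR (aOfS (permS t (sParam a)))) (qR (aOfS (permS t (sParam a)))) x' y'
    rw [hg2]

/-! ### The set cocycle for the Möbius generator `(56)` at loss-free directions -/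

/-- **Set cocycle for `(56)`.** Let `s = sParam a` satisfy `s₅, s₆ ≠ s₀` and `s₃+s₅, s₃+s₆, s₄+s₅, s₄+s₆ ≠ 0` (open
box), and suppose every critical point of `a` AND of `(56)·a` is loss-free for the Möbius map (`y′ ≠ 0`, `Q₅ ≠ 0`,
the two conditions of `isCritical_growthLogR_swap45`, at the respective parameters). Then
`critVals ((56)·a) = critVals a + ΔE((56); a)`. -/
theorem critVals_permAct_swap45 {a : Dir} (h05 : sParam a 5 ≠ sParam a 0) (h06 : sParam a 6 ≠ sParam a 0)
    (h35 : sParam a 3 + sParam a 5 ≠ 0) (h36 : sParam a 3 + sParam a 6 ≠ 0) (h45 : sParam a 4 + sParam a 5 ≠ 0)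
    (h46 : sParam a 4 + sParam a 6 ≠ 0)
    (hN : ∀ x y : ℝ, IsCritical a x y → y - sParam a 6 + sParam a 5 ≠ 0
      ∧ (y - sParam a 6 + sParam a 5) * ((sParam a 1 + sParam a 2 + sParam a 6 + sParam a 7 - y)
          * (sParam a 0 + sParam a 6 - y))
        - (y - (sParam a 1 + sParam a 6)) * (y - (sParam a 2 + sParam a 6)) * (y - (sParam a 6 + sParam a 7)) ≠ 0)
    (hN' : ∀ x y : ℝ, IsCritical (permAct (Equiv.swap 4 5) a) x y → y - sParam a 5 + sParam a 6 ≠ 0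
      ∧ (y - sParam a 5 + sParam a 6) * ((sParam a 1 + sParam a 2 + sParam a 5 + sParam a 7 - y)
          * (sParam a 0 + sParam a 5 - y))
        - (y - (sParam a 1 + sParam a 5)) * (y - (sParam a 2 + sParam a 5)) * (y - (sParam a 5 + sParam a 7)) ≠ 0) :
    critVals (permAct (Equiv.swap 4 5) a)
      = (fun v => v + ∑ i ∈ FIdx, (h28 (permAct (Equiv.swap 4 5) a) i * Real.log (h28 (permAct (Equiv.swap 4 5) a) i)
          - h28 a i * Real.log (h28 a i))) '' critVals a := by
  obtain ⟨e0, e1, e2, e3, e4, e5, e6, e7⟩ := permS_swap45_apply (sParam a)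
  refine critVals_permAct_eq_image_of_transfer_at (Equiv.swap_mul_self 4 5) a ?_ ?_
  · intro x y hc
    have hc0 : IsCritical a x y := by rwa [aOfS_sParam] at hc
    obtain ⟨hy5, hQ5⟩ := hN x y hc0
    set P := (y - (sParam a 1 + sParam a 6)) * (y - (sParam a 2 + sParam a 6)) * (y - (sParam a 6 + sParam a 7))
      with hP
    set Q5 := (y - sParam a 6 + sParam a 5) * ((sParam a 1 + sParam a 2 + sParam a 6 + sParam a 7 - y)
        * (sParam a 0 + sParam a 6 - y)) - P with hQ5'
    refine ⟨(sParam a 5 - sParam a 0) * P / Q5 - y + sParam a 5 + sParam a 6, y - sParam a 6 + sParam a 5,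
      isCritical_growthLogR_swap45 h05 h06 h35 h36 h45 h46 hc hy5 ?_⟩
    rw [← hP, ← hQ5']
    rw [show (sParam a 5 - sParam a 0) * P / Q5 - y + sParam a 5 + sParam a 6 + y - sParam a 5 - sParam a 6
      = (sParam a 5 - sParam a 0) * P / Q5 by ring, div_mul_cancel₀ _ hQ5]
  · intro x y hc
    have hc0 : IsCritical (permAct (Equiv.swap 4 5) a) x y := hc
    obtain ⟨hy5, hQ5⟩ := hN' x y hc0
    set s' := permS (Equiv.swap 4 5) (sParam a) with hs'
    have h05' : s' 5 ≠ s' 0 := by rw [e5, e0]; exact h06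
    have h06' : s' 6 ≠ s' 0 := by rw [e6, e0]; exact h05
    have h35' : s' 3 + s' 5 ≠ 0 := by rw [e3, e5]; exact h36
    have h36' : s' 3 + s' 6 ≠ 0 := by rw [e3, e6]; exact h35
    have h45' : s' 4 + s' 5 ≠ 0 := by rw [e4, e5]; exact h46
    have h46' : s' 4 + s' 6 ≠ 0 := by rw [e4, e6]; exact h45
    have hy5' : y - s' 6 + s' 5 ≠ 0 := by rw [e6, e5]; exact hy5
    set P := (y - (s' 1 + s' 6)) * (y - (s' 2 + s' 6)) * (y - (s' 6 + s' 7)) with hP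
    set Q5 := (y - s' 6 + s' 5) * ((s' 1 + s' 2 + s' 6 + s' 7 - y) * (s' 0 + s' 6 - y)) - P with hQ5'
    have hQ5ne : Q5 ≠ 0 := by rw [hQ5', hP, e0, e1, e2, e5, e6, e7]; exact hQ5
    refine ⟨(s' 5 - s' 0) * P / Q5 - y + s' 5 + s' 6, y - s' 6 + s' 5,
      isCritical_growthLogR_swap45 h05' h06' h35' h36' h45' h46' hc hy5' ?_⟩
    rw [← hP, ← hQ5']
    rw [show (s' 5 - s' 0) * P / Q5 - y + s' 5 + s' 6 + y - s' 5 - s' 6 = (s' 5 - s' 0) * P / Q5 by ring,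
      div_mul_cancel₀ _ hQ5ne]

/-! ### The cocycle property and products -/

/-- **`ΔE` is a cocycle**: `ΔE(gh; a) = ΔE(g; a) + ΔE(h; g·a)` (the action is `(gh)·a = h·(g·a)`). -/
theorem entropyCocycle_mul (g h : Equiv.Perm (Fin 7)) (a : Dir) :
    ∑ i ∈ FIdx, (h28 (permAct (g * h) a) i * Real.log (h28 (permAct (g * h) a) i) - h28 a i * Real.log (h28 a i))
      = ∑ i ∈ FIdx, (h28 (permAct g a) i * Real.log (h28 (permAct g a) i) - h28 a i * Real.log (h28 a i))
        + ∑ i ∈ FIdx, (h28 (permAct h (permAct g a)) i * Real.log (h28 (permAct h (permAct g a)) i)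
          - h28 (permAct g a) i * Real.log (h28 (permAct g a) i)) := by
  rw [← permAct_permAct, ← Finset.sum_add_distrib]
  refine Finset.sum_congr rfl fun i _ => ?_
  ring

/-- Translating a set twice. -/
theorem image_add_image_add (S : Set ℝ) (E₁ E₂ : ℝ) :
    (fun v => v + E₂) '' ((fun v => v + E₁) '' S) = (fun v => v + (E₁ + E₂)) '' S := by
  rw [Set.image_image]
  refine Set.image_congr' fun v => ?_
  ring

/-- **The set cocycle is closed under products** on an orbit-closed set of directions. -/
theorem critShift_mul {S : Set Dir} (hS : ∀ a ∈ S, ∀ g : Equiv.Perm (Fin 7), permAct g a ∈ S)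
    {g h : Equiv.Perm (Fin 7)}
    (hg : ∀ a ∈ S, critVals (permAct g a) = (fun v => v + ∑ i ∈ FIdx, (h28 (permAct g a) i
      * Real.log (h28 (permAct g a) i) - h28 a i * Real.log (h28 a i))) '' critVals a)
    (hh : ∀ a ∈ S, critVals (permAct h a) = (fun v => v + ∑ i ∈ FIdx, (h28 (permAct h a) i
      * Real.log (h28 (permAct h a) i) - h28 a i * Real.log (h28 a i))) '' critVals a) :
    ∀ a ∈ S, critVals (permAct (g * h) a) = (fun v => v + ∑ i ∈ FIdx, (h28 (permAct (g * h) a) i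
      * Real.log (h28 (permAct (g * h) a) i) - h28 a i * Real.log (h28 a i))) '' critVals a := by
  intro a ha
  rw [entropyCocycle_mul, ← image_add_image_add, ← hg a ha, ← hh (permAct g a) (hS a ha g), permAct_permAct]

/-- The set cocycle for the identity. -/
theorem critShift_one (a : Dir) :
    critVals (permAct 1 a) = (fun v => v + ∑ i ∈ FIdx, (h28 (permAct 1 a) i * Real.log (h28 (permAct 1 a) i)
      - h28 a i * Real.log (h28 a i))) '' critVals a := by
  simp [permAct_one]

/-! ### All of `S₇` on non-degenerate orbits -/

/-- Short words in the generators `(34) = swap 2 3`, `(45) = swap 3 4`, `π = swap 0 3 * swap 1 2 * swap 4 6`,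
`(56) = swap 4 5` for the transpositions needed to reach the six adjacent transpositions of `Fin 7`. -/
theorem swap_words :
    (Equiv.swap (2 : Fin 7) 3 * Equiv.swap 3 4 * Equiv.swap 2 3 = Equiv.swap 2 4)
    ∧ (Equiv.swap (2 : Fin 7) 4 * Equiv.swap 4 5 * Equiv.swap 2 4 = Equiv.swap 2 5)
    ∧ ((Equiv.swap (0 : Fin 7) 3 * Equiv.swap 1 2 * Equiv.swap 4 6) * Equiv.swap 2 5
        * (Equiv.swap 0 3 * Equiv.swap 1 2 * Equiv.swap 4 6) = Equiv.swap 1 5)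
    ∧ (Equiv.swap (2 : Fin 7) 5 * Equiv.swap 1 5 * Equiv.swap 2 5 = Equiv.swap 1 2)
    ∧ ((Equiv.swap (0 : Fin 7) 3 * Equiv.swap 1 2 * Equiv.swap 4 6) * Equiv.swap 2 3
        * (Equiv.swap 0 3 * Equiv.swap 1 2 * Equiv.swap 4 6) = Equiv.swap 0 1)
    ∧ ((Equiv.swap (0 : Fin 7) 3 * Equiv.swap 1 2 * Equiv.swap 4 6) * Equiv.swap 4 5
        * (Equiv.swap 0 3 * Equiv.swap 1 2 * Equiv.swap 4 6) = Equiv.swap 5 6) := by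
  refine ⟨?_, ?_, ?_, ?_, ?_, ?_⟩ <;> decide

/-- The six adjacent transpositions of `Fin 7`, by value. -/
theorem swap_castSucc_succ_cases (i : Fin 6) :
    (Equiv.swap i.castSucc i.succ : Equiv.Perm (Fin 7)) = Equiv.swap 0 1
    ∨ (Equiv.swap i.castSucc i.succ : Equiv.Perm (Fin 7)) = Equiv.swap 1 2
    ∨ (Equiv.swap i.castSucc i.succ : Equiv.Perm (Fin 7)) = Equiv.swap 2 3
    ∨ (Equiv.swap i.castSucc i.succ : Equiv.Perm (Fin 7)) = Equiv.swap 3 4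
    ∨ (Equiv.swap i.castSucc i.succ : Equiv.Perm (Fin 7)) = Equiv.swap 4 5
    ∨ (Equiv.swap i.castSucc i.succ : Equiv.Perm (Fin 7)) = Equiv.swap 5 6 := by
  fin_cases i
  · exact Or.inl rfl
  · exact Or.inr (Or.inl rfl)
  · exact Or.inr (Or.inr (Or.inl rfl))
  · exact Or.inr (Or.inr (Or.inr (Or.inl rfl)))
  · exact Or.inr (Or.inr (Or.inr (Or.inr (Or.inl rfl))))
  · exact Or.inr (Or.inr (Or.inr (Or.inr (Or.inr rfl))))

/-- **The critical-value cocycle on non-degenerate orbits.** Let `S` be an `S₇`-stable set of directions inside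
the open box on which every direction is loss-free for the Möbius generator `(56)`. Then for every `g ∈ S₇` and
every `a ∈ S`: `critVals (g·a) = critVals a + ΔE(g; a)`. -/
theorem critVals_permAct_of_nondegenerate_set {S : Set Dir} (hS : ∀ a ∈ S, ∀ g : Equiv.Perm (Fin 7), permAct g a ∈ S)
    (hbox : ∀ a ∈ S, ∀ j : Fin 7, 0 < sParam a j.succ ∧ sParam a j.succ < sParam a 0)
    (hN : ∀ a ∈ S, ∀ x y : ℝ, IsCritical a x y → y - sParam a 6 + sParam a 5 ≠ 0
      ∧ (y - sParam a 6 + sParam a 5) * ((sParam a 1 + sParam a 2 + sParam a 6 + sParam a 7 - y)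
          * (sParam a 0 + sParam a 6 - y))
        - (y - (sParam a 1 + sParam a 6)) * (y - (sParam a 2 + sParam a 6)) * (y - (sParam a 6 + sParam a 7)) ≠ 0)
    (g : Equiv.Perm (Fin 7)) :
    ∀ a ∈ S, critVals (permAct g a) = (fun v => v + ∑ i ∈ FIdx, (h28 (permAct g a) i
      * Real.log (h28 (permAct g a) i) - h28 a i * Real.log (h28 a i))) '' critVals a := by
  -- the four generators on `S`
  have G23 : ∀ a ∈ S, critVals (permAct (Equiv.swap 2 3) a) = (fun v => v + ∑ i ∈ FIdx,
      (h28 (permAct (Equiv.swap 2 3) a) i * Real.log (h28 (permAct (Equiv.swap 2 3) a) i)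
        - h28 a i * Real.log (h28 a i))) '' critVals a := fun a _ => critVals_permAct_swap23 a
  have G34 : ∀ a ∈ S, critVals (permAct (Equiv.swap 3 4) a) = (fun v => v + ∑ i ∈ FIdx,
      (h28 (permAct (Equiv.swap 3 4) a) i * Real.log (h28 (permAct (Equiv.swap 3 4) a) i)
        - h28 a i * Real.log (h28 a i))) '' critVals a := fun a _ => critVals_permAct_swap34 a
  have Gπ : ∀ a ∈ S, critVals (permAct (Equiv.swap 0 3 * Equiv.swap 1 2 * Equiv.swap 4 6) a) = (fun v => v
      + ∑ i ∈ FIdx, (h28 (permAct (Equiv.swap 0 3 * Equiv.swap 1 2 * Equiv.swap 4 6) a) i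
        * Real.log (h28 (permAct (Equiv.swap 0 3 * Equiv.swap 1 2 * Equiv.swap 4 6) a) i)
        - h28 a i * Real.log (h28 a i))) '' critVals a := fun a _ => critVals_permAct_mirror a
  have G45 : ∀ a ∈ S, critVals (permAct (Equiv.swap 4 5) a) = (fun v => v + ∑ i ∈ FIdx,
      (h28 (permAct (Equiv.swap 4 5) a) i * Real.log (h28 (permAct (Equiv.swap 4 5) a) i)
        - h28 a i * Real.log (h28 a i))) '' critVals a := by
    intro a ha
    have hb := hbox a ha
    have h0 : 0 < sParam a 0 := (hb 0).1.trans (hb 0).2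
    have hsw : sParam (permAct (Equiv.swap 4 5) a) = permS (Equiv.swap 4 5) (sParam a) := sParam_permAct _ _
    obtain ⟨e0, e1, e2, e3, e4, e5, e6, e7⟩ := permS_swap45_apply (sParam a)
    refine critVals_permAct_swap45 (ne_of_lt (hb 4).2) (ne_of_lt (hb 5).2)
      (ne_of_gt (add_pos (hb 2).1 (hb 4).1)) (ne_of_gt (add_pos (hb 2).1 (hb 5).1))
      (ne_of_gt (add_pos (hb 3).1 (hb 4).1)) (ne_of_gt (add_pos (hb 3).1 (hb 5).1)) (hN a ha) ?_
    intro x y hc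
    have := hN (permAct (Equiv.swap 4 5) a) (hS a ha _) x y hc
    rw [hsw, e0, e1, e2, e5, e6, e7] at this
    exact this
  -- every permutation is a product of adjacent transpositions
  have hσ : g ∈ Submonoid.closure (Set.range fun i : Fin 6 => Equiv.swap i.castSucc i.succ) := by
    rw [Equiv.Perm.mclosure_swap_castSucc_succ]; exact Submonoid.mem_top g
  obtain ⟨e24, e25, e15, e12, e01, e56⟩ := swap_words
  have G24 := critShift_mul hS (critShift_mul hS G23 G34) G23
  rw [e24] at G24
  have G25 := critShift_mul hS (critShift_mul hS G24 G45) G24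
  rw [e25] at G25
  have G15 := critShift_mul hS (critShift_mul hS Gπ G25) Gπ
  rw [e15] at G15
  have G12 := critShift_mul hS (critShift_mul hS G25 G15) G25
  rw [e12] at G12
  have G01 := critShift_mul hS (critShift_mul hS Gπ G23) Gπ
  rw [e01] at G01
  have G56 := critShift_mul hS (critShift_mul hS Gπ G45) Gπ
  rw [e56] at G56
  induction hσ using Submonoid.closure_induction with
  | one => exact fun a _ => critShift_one a
  | mul τ₁ τ₂ _ _ h₁ h₂ => exact critShift_mul hS h₁ h₂
  | mem τ hτ =>
    obtain ⟨i, rfl⟩ := hτ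
    rcases swap_castSucc_succ_cases i with h | h | h | h | h | h <;> dsimp only <;> rw [h]
    exacts [G01, G12, G23, G34, G45, G56]

/-- **The critical-value cocycle on a non-degenerate orbit.** If `a` lies in the open box and every direction of
its `S₇`-orbit is loss-free for `(56)` (at its own parameters), then `critVals (g·a) = critVals a + ΔE(g; a)` for
every `g ∈ S₇`. -/
theorem critVals_permAct_of_nondegenerate {a : Dir} (hbox : ∀ j : Fin 7, 0 < sParam a j.succ ∧ sParam a j.succ < sParam a 0)
    (hN : ∀ (g : Equiv.Perm (Fin 7)) (x y : ℝ), IsCritical (permAct g a) x y →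
      y - sParam (permAct g a) 6 + sParam (permAct g a) 5 ≠ 0
      ∧ (y - sParam (permAct g a) 6 + sParam (permAct g a) 5)
          * ((sParam (permAct g a) 1 + sParam (permAct g a) 2 + sParam (permAct g a) 6 + sParam (permAct g a) 7 - y)
            * (sParam (permAct g a) 0 + sParam (permAct g a) 6 - y))
        - (y - (sParam (permAct g a) 1 + sParam (permAct g a) 6)) * (y - (sParam (permAct g a) 2 + sParam (permAct g a) 6))
          * (y - (sParam (permAct g a) 6 + sParam (permAct g a) 7)) ≠ 0)
    (g : Equiv.Perm (Fin 7)) :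
    critVals (permAct g a) = (fun v => v + ∑ i ∈ FIdx, (h28 (permAct g a) i * Real.log (h28 (permAct g a) i)
      - h28 a i * Real.log (h28 a i))) '' critVals a := by
  refine critVals_permAct_of_nondegenerate_set (S := {b | ∃ g : Equiv.Perm (Fin 7), b = permAct g a}) ?_ ?_ ?_ g a
    ⟨1, (permAct_one a).symm⟩
  · rintro b ⟨g', rfl⟩ h
    exact ⟨g' * h, permAct_permAct h g' a⟩
  · rintro b ⟨g', rfl⟩ j
    rw [sParam_permAct_succ, sParam_permAct_zero]
    exact hbox (g' j)
  · rintro b ⟨g', rfl⟩ x y hc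
    exact hN g' x y hc

/-- **`Regular` is a class function on non-degenerate orbits.** -/
theorem regular_permAct_of_nondegenerate {a : Dir} (hbox : ∀ j : Fin 7, 0 < sParam a j.succ ∧ sParam a j.succ < sParam a 0)
    (hN : ∀ (g : Equiv.Perm (Fin 7)) (x y : ℝ), IsCritical (permAct g a) x y →
      y - sParam (permAct g a) 6 + sParam (permAct g a) 5 ≠ 0
      ∧ (y - sParam (permAct g a) 6 + sParam (permAct g a) 5)
          * ((sParam (permAct g a) 1 + sParam (permAct g a) 2 + sParam (permAct g a) 6 + sParam (permAct g a) 7 - y)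
            * (sParam (permAct g a) 0 + sParam (permAct g a) 6 - y))
        - (y - (sParam (permAct g a) 1 + sParam (permAct g a) 6)) * (y - (sParam (permAct g a) 2 + sParam (permAct g a) 6))
          * (y - (sParam (permAct g a) 6 + sParam (permAct g a) 7)) ≠ 0)
    (hreg : Regular a) (g : Equiv.Perm (Fin 7)) : Regular (permAct g a) :=
  regular_of_critVals_eq_image hreg (critVals_permAct_of_nondegenerate hbox hN g)

/-- **`γ` is a class function on non-degenerate orbits of the open box** (the hypotheses of P2 g20's
`gamma_permAct_of_critShift` discharged where they hold): `γ(g·a) = γ(a)` for every `g ∈ S₇`. -/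
theorem gamma_permAct_of_nondegenerate {a : Dir} (hbox : ∀ j : Fin 7, 0 < sParam a j.succ ∧ sParam a j.succ < sParam a 0)
    (hN : ∀ (g : Equiv.Perm (Fin 7)) (x y : ℝ), IsCritical (permAct g a) x y →
      y - sParam (permAct g a) 6 + sParam (permAct g a) 5 ≠ 0
      ∧ (y - sParam (permAct g a) 6 + sParam (permAct g a) 5)
          * ((sParam (permAct g a) 1 + sParam (permAct g a) 2 + sParam (permAct g a) 6 + sParam (permAct g a) 7 - y)
            * (sParam (permAct g a) 0 + sParam (permAct g a) 6 - y))
        - (y - (sParam (permAct g a) 1 + sParam (permAct g a) 6)) * (y - (sParam (permAct g a) 2 + sParam (permAct g a) 6))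
          * (y - (sParam (permAct g a) 6 + sParam (permAct g a) 7)) ≠ 0)
    (hreg : Regular a) (g : Equiv.Perm (Fin 7)) : gamma (permAct g a) = gamma a := by
  have h0 : 0 < sParam a 0 := (hbox 0).1.trans (hbox 0).2
  have hB : BZBox a := ⟨h0, fun j => ⟨(hbox j).1.le, (hbox j).2.le⟩⟩
  have hcv := critVals_permAct_of_nondegenerate hbox hN g
  exact gamma_permAct_of_critShift hB g (C1_of_critVals_eq_image hreg hcv) (C0_of_critVals_eq_image hreg hcv)

end Summit.KontsevichZagierPeriods.Zeta5Search.Barrier.ConeGamma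

end
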